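import Summits.CriticalPhenomena.PercolationContinuityZ3.Theorems.Transplant.SkelSignClosureResidues
import Summits.CriticalPhenomena.PercolationContinuityZ3.Theorems.Transplant.SkelConcChoice
import HarnessLib

/-!
# D″ L7′ params, part 4 (φ-level, consumer-independent): THE ACCURACIES OF `signChoice₀` — fixed BEFORE Step I′ from the handed constants
# `κ : SkelConc.Consts` and the degree bound (addendum N.3: `… → A → L → n_F, n_R → δI := (min{δ, δ₂, δ_A(n_F), δr(n_R)})²/16 → Step I′`):
# the chain-length budget `Skelφ.Prm.nmax A := 40·A + 1000` (covers the (F) inner runs `≤ L + 22A/L + O(1)` and the root run; instance-side, so no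
# cycle with `κ`), the INNER accuracy `Skelφ.Prm.δAcc G hΔ N ε := min_{n ≤ N} Skelφ.δUP G hΔ n ε` (p3-g7's `δUP`, p250290) with its ∀-n chain property,
# the minimal ROOT accuracy `Skelφ.Prm.δrMin κ N := min_{n ≤ N} κ.δr n`, the KIT accuracy `Skelφ.Prm.δkit := min (min κ.δ κ.δ₂) (min δrMin δAcc)` and the
# Step-I′ accuracy `Skelφ.Prm.δI := δkit² / 16`; every `≤`/positivity lemma the unpacking files need — ledger HOME/prim-bschramm-stmt/SIGN-PARAMS.md §0 (c1)

builds on p205010 (kernel theorem, internal audit signed; external expert review pending) — nothing in this file uses p205010.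
Status sentence (coordinator 2026-08-20T04:30Z): "θ(p_c) = 0 on ℤ^d, all d ≥ 2 — kernel-verified (Lean 4/Mathlib, standard axioms); internal adversarial
audit SIGNED 2026-08-20 04:29Z; external expert review pending."
Lane `prim-bschramm-*`, seat `prim-bschramm-stmt` (gen 9); helper file (`--supports stmt-CriticalPhenomena-4575`).
* §1 `nmax`, `δAcc` + `δAcc_le_δUP`, `δAcc_pos`, `δAcc_le_one`, **`δAcc_spec`** (the chain property of EVERY length `n ≤ N` at accuracy `δAcc`, every `q < 1`,
  every subgraph — `δUP_spec` + `KitsAt.mono`);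
* §2 `δrMin` + `δrMin_le`, `δrMin_pos`, `δrMin_le_one`;
* §3 `δkit κ G hΔ A`, `δI` + `δkit_le_δ/δ₂/δr/δAcc`, `δkit_pos`, `δkit_le_one`, `δI_pos`, `δI_le_sq` (`δI ≤ a²` whenever `δkit ≤ 4a`… stated as `δI ≤ δkit²`),
  `inputs_mono` (an input certified at `1 − δI` is certified at `1 − a` for every `a ≥ δI`).
[cite: KozmaNitzan2024, §4 Theorem 6 (pp. 25–31): the order of constants; Lemma 11 (p. 22), Lemma 12 (pp. 23–25)]
-/

noncomputable section

open MeasureTheory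
open scoped Classical

namespace Summit.CriticalPhenomena.PercolationContinuityZ3.Theorems.Transplant

namespace Skelφ

namespace Prm

open Literature.Probability.Percolation Literature.Probability.LatticeModels SimpleGraph KNLevels
open SkelConc (Consts)

variable {V : Type} [DecidableEq V] [Countable V] (G : SimpleGraph V) [G.LocallyFinite] {Δ : ℕ} (hΔ : ∀ v, G.degree v ≤ Δ)

/-! ## §1 The chain-length budget and the inner accuracy -/

omit [DecidableEq V] [Countable V] [G.LocallyFinite] in
/-- **The chain-length budget** `nmax A := 40·A + 1000` for the (F) inner runs and the root run (addendum N.3: `≤ L + 22A/L + O(1)`, `L ≤ A/17`). [this work] -/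
def nmax (A : ℕ) : ℕ := 40 * A + 1000

/-- **The inner accuracy** `δAcc N ε := min_{n ≤ N} δUP n ε`: ONE accuracy below the chain accuracy of every length `≤ N`. [this work] -/
def δAcc (N : ℕ) (ε : ℝ) : ℝ :=
  ((Finset.range (N + 1)).image fun n => δUP G hΔ n ε).min' ⟨δUP G hΔ 0 ε, Finset.mem_image.2 ⟨0, by simp, rfl⟩⟩

/-- `δAcc N ε ≤ δUP n ε` for `n ≤ N`. [folklore] -/
theorem δAcc_le_δUP (N : ℕ) (ε : ℝ) {n : ℕ} (hn : n ≤ N) : δAcc G hΔ N ε ≤ δUP G hΔ n ε :=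
  Finset.min'_le _ _ (Finset.mem_image.2 ⟨n, Finset.mem_range.2 (Nat.lt_succ_of_le hn), rfl⟩)

/-- `0 < δAcc`. [folklore] -/
theorem δAcc_pos (N : ℕ) (ε : ℝ) : 0 < δAcc G hΔ N ε := by
  unfold δAcc
  refine (Finset.lt_min'_iff _ _).2 fun y hy => ?_
  obtain ⟨n, -, rfl⟩ := Finset.mem_image.1 hy
  exact δUP_pos G hΔ n _

/-- `δAcc ≤ 1`. [folklore] -/
theorem δAcc_le_one (N : ℕ) (ε : ℝ) : δAcc G hΔ N ε ≤ 1 := (δAcc_le_δUP G hΔ N ε (Nat.zero_le _)).trans (δUP_le_one G hΔ 0 _)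

/-- **The chain property of EVERY length `n ≤ N` at the accuracy `δAcc N ε`**, in every subgraph `G' ≤ G`, for every `q < 1`, delivering `1 − ε`
(`δUP_spec` + `KitsAt.mono`). [cite: KozmaNitzan2024, §4 Lemma 11 (p. 22), Lemma 12 (pp. 23–25)] -/
theorem δAcc_spec (N : ℕ) {ε : ℝ} (hε : 0 < ε) {n : ℕ} (hn : n ≤ N) {q : unitInterval} (hq1 : (q : ℝ) < 1)
    (G' : SimpleGraph V) [G'.LocallyFinite] (hG' : G' ≤ G) :
    ∀ (Wt : Sym2 V → unitInterval) (s : Fin (n + 1) → TStep G') (T' : Fin (n + 1) → Finset V) (η : ℝ),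
      (∀ i : Fin (n + 1), (s i).L.o = (s 0).L.o) →
      (∀ i : Fin n, T' (Fin.castSucc i) ⊆ (s i.succ).L.X 0) →
      (∀ i : Fin (n + 1), T' i ⊆ (s i).T) →
      (∀ i : Fin (n + 1), (s i).KitsAt Wt q Δ (δAcc G hΔ N ε)) →
      η ≤ δAcc G hΔ N ε / 2 →
      (∀ i : Fin (n + 1), (prodBernoulli Wt).real (⋃ t ∈ (s i).T \ T' i, openConn (s 0).L.o t) ≤ η) →
      1 - δAcc G hΔ N ε < (prodBernoulli Wt).real (s 0).L.reachB →
        1 - ε < (prodBernoulli Wt).real (⋃ t ∈ T' (Fin.last n), openConn (s 0).L.o t) := by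
  intro Wt s T' η ho hlink hsub hkits hη hexc hsrc
  have hle := δAcc_le_δUP G hΔ N ε hn
  exact δUP_spec G hΔ n hε q hq1 G' hG' Wt s T' η ho hlink hsub (fun i => (hkits i).mono hle) (hη.trans (by linarith)) hexc (by linarith)

/-! ## §2 The minimal root accuracy -/

omit [DecidableEq V] [Countable V] [G.LocallyFinite] in
/-- **The minimal root accuracy** `δrMin κ N := min_{n ≤ N} κ.δr n` (serves a root run of ANY length `≤ N`). [this work] -/
def δrMin (κ : Consts) (N : ℕ) : ℝ :=
  ((Finset.range (N + 1)).image κ.δr).min' ⟨κ.δr 0, Finset.mem_image.2 ⟨0, by simp, rfl⟩⟩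

omit [DecidableEq V] [Countable V] [G.LocallyFinite] in
/-- `δrMin ≤ δr n` for `n ≤ N`. [folklore] -/
theorem δrMin_le (κ : Consts) (N : ℕ) {n : ℕ} (hn : n ≤ N) : δrMin κ N ≤ κ.δr n :=
  Finset.min'_le _ _ (Finset.mem_image.2 ⟨n, Finset.mem_range.2 (Nat.lt_succ_of_le hn), rfl⟩)

omit [DecidableEq V] [Countable V] [G.LocallyFinite] in
/-- `0 < δrMin`. [folklore] -/
theorem δrMin_pos (κ : Consts) (N : ℕ) : 0 < δrMin κ N := by
  unfold δrMin
  refine (Finset.lt_min'_iff _ _).2 fun y hy => ?_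
  obtain ⟨n, -, rfl⟩ := Finset.mem_image.1 hy
  exact (κ.hδr n).1

omit [DecidableEq V] [Countable V] [G.LocallyFinite] in
/-- `δrMin ≤ 1`. [folklore] -/
theorem δrMin_le_one (κ : Consts) (N : ℕ) : δrMin κ N ≤ 1 := (δrMin_le κ N (Nat.zero_le _)).trans (κ.hδr 0).2

/-! ## §3 The kit accuracy and the Step-I′ accuracy -/

/-- **The kit accuracy** `δkit := min (min δ δ₂) (min (δrMin κ (nmax A)) (δAcc (nmax A) (δ₂²)))`: below the corridor-kit accuracy `κ.δ`, the face-kit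
accuracy `κ.δ₂`, every root-chain accuracy `κ.δr n` and every inner-chain accuracy (`n ≤ nmax A`; the inner runs deliver `1 − δ₂²`). [this work] -/
def δkit (κ : Consts) (A : ℕ) : ℝ := min (min κ.δ κ.δ₂) (min (δrMin κ (nmax A)) (δAcc G hΔ (nmax A) (κ.δ₂ ^ 2)))

/-- **The Step-I′ accuracy** `δI := δkit² / 16`. [this work] -/
def δI (κ : Consts) (A : ℕ) : ℝ := δkit G hΔ κ A ^ 2 / 16

/-- `δkit ≤ δ`. [folklore] -/
theorem δkit_le_δ (κ : Consts) (A : ℕ) : δkit G hΔ κ A ≤ κ.δ := (min_le_left _ _).trans (min_le_left _ _)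

/-- `δkit ≤ δ₂`. [folklore] -/
theorem δkit_le_δ₂ (κ : Consts) (A : ℕ) : δkit G hΔ κ A ≤ κ.δ₂ := (min_le_left _ _).trans (min_le_right _ _)

/-- `δkit ≤ δr n` for every `n ≤ nmax A`. [folklore] -/
theorem δkit_le_δr (κ : Consts) (A : ℕ) {n : ℕ} (hn : n ≤ nmax A) : δkit G hΔ κ A ≤ κ.δr n :=
  ((min_le_right _ _).trans (min_le_left _ _)).trans (δrMin_le κ _ hn)

/-- `δkit ≤ δAcc (nmax A) (δ₂²)` (hence `≤ δUP n (δ₂²)` for every `n ≤ nmax A`). [folklore] -/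
theorem δkit_le_δAcc (κ : Consts) (A : ℕ) : δkit G hΔ κ A ≤ δAcc G hΔ (nmax A) (κ.δ₂ ^ 2) := (min_le_right _ _).trans (min_le_right _ _)

/-- `δkit ≤ δUP n (δ₂²)` for `n ≤ nmax A`. [folklore] -/
theorem δkit_le_δUP (κ : Consts) (A : ℕ) {n : ℕ} (hn : n ≤ nmax A) : δkit G hΔ κ A ≤ δUP G hΔ n (κ.δ₂ ^ 2) :=
  (δkit_le_δAcc G hΔ κ A).trans (δAcc_le_δUP G hΔ _ _ hn)

/-- `0 < δkit`. [folklore] -/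
theorem δkit_pos (κ : Consts) (A : ℕ) : 0 < δkit G hΔ κ A :=
  lt_min (lt_min κ.hδ0 κ.hδ₂0) (lt_min (δrMin_pos κ _) (δAcc_pos G hΔ _ _))

/-- `δkit ≤ 1`. [folklore] -/
theorem δkit_le_one (κ : Consts) (A : ℕ) : δkit G hΔ κ A ≤ 1 := (δkit_le_δ G hΔ κ A).trans κ.hδ1

/-- `0 < δI`. [folklore] -/
theorem δI_pos (κ : Consts) (A : ℕ) : 0 < δI G hΔ κ A := by
  unfold δI; have := δkit_pos G hΔ κ A; positivity

/-- `δI ≤ δkit²`. [folklore] -/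
theorem δI_le_sq (κ : Consts) (A : ℕ) : δI G hΔ κ A ≤ δkit G hΔ κ A ^ 2 := by
  unfold δI; have := sq_nonneg (δkit G hΔ κ A); linarith

/-- `δI ≤ (δkit/4)²` (indeed equal): inputs at `1 − δI` serve every transfer losing a factor `≤ 16`. [folklore] -/
theorem δI_eq (κ : Consts) (A : ℕ) : δI G hΔ κ A = (δkit G hΔ κ A / 4) ^ 2 := by unfold δI; ring

/-- `δI ≤ a²` whenever `δkit ≤ a` (the consumers' `inputs_at_le` pattern: kits at a coarser accuracy `a`). [folklore] -/
theorem δI_le_sq_of_le (κ : Consts) (A : ℕ) {a : ℝ} (ha : δkit G hΔ κ A ≤ a) : δI G hΔ κ A ≤ a ^ 2 :=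
  (δI_le_sq G hΔ κ A).trans (pow_le_pow_left₀ (δkit_pos G hΔ κ A).le ha 2)

/-- `δI ≤ 1`. [folklore] -/
theorem δI_le_one (κ : Consts) (A : ℕ) : δI G hΔ κ A ≤ 1 :=
  (δI_le_sq_of_le G hΔ κ A (δkit_le_one G hΔ κ A)).trans (by norm_num)

omit [DecidableEq V] [Countable V] [G.LocallyFinite] in
/-- **Input transfer to a coarser threshold**: `1 − b < P` from `1 − a < P` and `a ≤ b`. [folklore] -/
theorem inputs_mono {a b P : ℝ} (hab : a ≤ b) (h : 1 - a < P) : 1 - b < P := by linarith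

end Prm

end Skelφ

end Summit.CriticalPhenomena.PercolationContinuityZ3.Theorems.Transplant

end
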